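import Summits.SmoothPoincare4.SmoothPoincare4.Theses.EntropyRung
import Summits.SmoothPoincare4.SmoothPoincare4.Theorems.EntropyRungSubcylindricalExistenceGluingCore
import Summits.SmoothPoincare4.SmoothPoincare4.Theorems.EntropyRungSubcylindricalExistenceGluingLocalisation
import Summits.SmoothPoincare4.SmoothPoincare4.Theorems.EntropyRungSubcylindricalExistenceGluingConstants
import Summits.SmoothPoincare4.SmoothPoincare4.Theorems.EntropyRungSubcylindricalExistenceGluingSmallScales
import HarnessLib

/-!
# Small scales of the conformally-round-capped blow-up (line `green-blowup-conformal-entropy`,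
# reshape R-c3 "Schwarzschild gauge", crux `EntropyRung.SubcylindricalExistence`,
# stmt-SmoothPoincare4-10871; helper for Stub D' `stub_conformalGluingSchwarzschild`)

The small-scale step of the lead's assembly in the Schwarzschild gauge, with all constants already
chosen. It is lead c2's `GluingSmallScales.smallScales_clause` (p116244) with ONE change: the cap
clause of the factor `ψ = ψ_K` is PERTURBATIVE — it holds at level `log 6 − 2 − 4ε` (not `log 6 − 2`)
for test functions supported in the capturing set `U` (in the application: the chart ball of radius
`ρ₁ = √(2a/S)`, level from the Euclidean cap clause E2 with `100θ = 4ε`). The room is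
`Negative.margin_gt`: `ν_cyl + ε + ε ≤ log 6 − 2 − 4ε` because `6ε ≤ 0.0195 < 0.026 < ν_rd − ν_cyl`
(`8ε ≤ 0.026`). Data: Green data `(g, p, G)` whose blow-up clears `ν_cyl + δ`; the cap factor `ψ`
(`ψ = 4KG/(4K+G)` off `p`, `L_g ψ > 0`) with its Yamabe–Sobolev constant `Y`; a logarithmic cut-off
pair `χ₁² + χ₂² = 1` at the level `S` whose annulus is captured by `U`; a bound `Λ` for `G⁻²|∇G|²` on
`{G < S³}`; a bound `Θ` for `√(∫(|∇χ₁|² + |∇χ₂|²)²)` with cost `(4/Y) C_Y⁺ Θ ≤ ε`; and the largeness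
conditions `2S³/ε ≤ K`, `16 T Λ ≤ ε² K²`, `8ε ≤ δ`, `8ε ≤ 0.026`. Conclusion (`smallScales_clause`):
for every scale `0 < τ ≤ T` and every normalised smooth `w`, the `ψ`-weighted clause holds at level
`ν_cyl + ε`. Proof: the core clause (`gluingCoreClause`, level `≥ ν_cyl + δ − 3ε`) on
`U₁ = {x ≠ p, G < S³} ⊇ tsupport χ₁`, the cap clause on `U ⊇ tsupport χ₂`, and the two-piece
localisation `gluingLocalisedClause` — all landed and gauge-free. Everything is proved; no
definitions, no named facts.
-/

noncomputable section

set_option linter.dupNamespace false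

open scoped Manifold ContDiff Topology
open Set Filter MeasureTheory
open Literature.Geometry.Lorentzian

namespace Summit.SmoothPoincare4.SmoothPoincare4.Theorems

namespace GluingSmallScalesSchwarzschild

variable {M : Type} [TopologicalSpace M] [T2Space M] [SecondCountableTopology M]
  [ChartedSpace (EuclideanSpace ℝ (Fin 4)) M] [IsManifold (𝓡 4) ∞ M] [CompactSpace M]
  [T3Space M] [MeasurableSpace M] [BorelSpace M]
  (g : PseudoRiemannianMetric (𝓡 4) ∞ (EuclideanSpace ℝ (Fin 4)) (TangentSpace (𝓡 4) : M → Type _))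

/-! ### The small-scale clause -/

/-- **The small-scale clause with a perturbative cap** (see the module docstring): lead c2's
`GluingSmallScales.smallScales_clause` with the cap clause at level `log 6 − 2 − 4ε`.
[cite: Perelman2002Entropy, §3.1] -/
theorem smallScales_clause [g.HasLeviCivita] (hg : g.IsRiemannian) {p : M} {G : M → ℝ}
    (hGs : ContMDiffOn (𝓡 4) 𝓘(ℝ, ℝ) ∞ G {p}ᶜ) (hGpos : ∀ x, x ≠ p → 0 < G x)
    (hGlim : Tendsto G (𝓝[≠] p) atTop) {δ : ℝ}
    (hBlow : ∀ τ : ℝ, 0 < τ → ∀ w : M → ℝ, ContMDiff (𝓡 4) 𝓘(ℝ, ℝ) ∞ w → w =ᶠ[𝓝 p] 0 →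
      ∫ x, (4 * Real.pi * τ) ^ (-(4 : ℝ) / 2) * (w x) ^ 2 * (G x) ^ 4
          ∂(riemannianMeasure (g.toContMDiffRiemannianMetric hg)) = 1 →
        Real.log 2 + Real.log Real.pi / 2 - 3 / 2 + δ ≤
          ∫ x, (4 * τ * ((G x)⁻¹ ^ 2 * g.gradSq w x) - (w x) ^ 2 * Real.log ((w x) ^ 2)
            - 4 * (w x) ^ 2) * ((4 * Real.pi * τ) ^ (-(4 : ℝ) / 2) * (G x) ^ 4)
          ∂(riemannianMeasure (g.toContMDiffRiemannianMetric hg)))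
    {K : ℝ} (hK : 0 < K) {ψ : M → ℝ} (hψ : ContMDiff (𝓡 4) 𝓘(ℝ, ℝ) ∞ ψ) (hψpos : ∀ x, 0 < ψ x)
    (hψG : ∀ x, x ≠ p → ψ x = 4 * K * G x / (4 * K + G x))
    (hLψ : ∀ x, 0 < g.scalarCurvature x * ψ x - 6 * g.dalembertian ψ x)
    {Y : ℝ} (hY : 0 < Y)
    (hYS : ∀ u : M → ℝ, ContMDiff (𝓡 4) 𝓘(ℝ, ℝ) ∞ u →
      Y * Real.sqrt (∫ x, u x ^ 4 * ψ x ^ 4 ∂(riemannianMeasure (g.toContMDiffRiemannianMetric hg))) ≤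
        ∫ x, (6 * (ψ x ^ 2 * g.gradSq u x)
            + ψ x * (g.scalarCurvature x * ψ x - 6 * g.dalembertian ψ x) * u x ^ 2)
          ∂(riemannianMeasure (g.toContMDiffRiemannianMetric hg)))
    {U : Set M} (hpU : p ∈ U) {ε : ℝ}
    (hcap : ∀ τ : ℝ, 0 < τ → ∀ v : M → ℝ, ContMDiff (𝓡 4) 𝓘(ℝ, ℝ) ∞ v → tsupport v ⊆ U →
      ∫ x, (4 * Real.pi * τ) ^ (-(4 : ℝ) / 2) * (v x) ^ 2 * (ψ x) ^ 4
          ∂(riemannianMeasure (g.toContMDiffRiemannianMetric hg)) = 1 →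
        Real.log 6 - 2 - 4 * ε ≤
          ∫ x, (τ * ((ψ x ^ 3)⁻¹ * (g.scalarCurvature x * ψ x - 6 * g.dalembertian ψ x) * (v x) ^ 2
                + 4 * ((ψ x)⁻¹ ^ 2 * g.gradSq v x))
            - (v x) ^ 2 * Real.log ((v x) ^ 2) - 4 * (v x) ^ 2)
            * ((4 * Real.pi * τ) ^ (-(4 : ℝ) / 2) * (ψ x) ^ 4)
          ∂(riemannianMeasure (g.toContMDiffRiemannianMetric hg)))
    {S : ℝ} (hS : 1 < S) {Λ : ℝ} (hΛ0 : 0 ≤ Λ)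
    (hΛ : ∀ x, x ≠ p → G x < S ^ 3 → (G x)⁻¹ ^ 2 * g.gradSq G x ≤ Λ)
    {χ₁ χ₂ : M → ℝ} (hχ₁ : ContMDiff (𝓡 4) 𝓘(ℝ, ℝ) ∞ χ₁) (hχ₂ : ContMDiff (𝓡 4) 𝓘(ℝ, ℝ) ∞ χ₂)
    (h1 : ∀ y, χ₁ y ^ 2 + χ₂ y ^ 2 = 1) (hone : ∀ x, x ≠ p → G x ≤ S → χ₁ x = 1)
    (hzero : ∀ x, x ≠ p → S ^ 2 ≤ G x → χ₁ x = 0) (hχ₁p : χ₁ p = 0)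
    (hcapt : ∀ x, x ≠ p → S ≤ G x → x ∈ U)
    {Θ T : ℝ} (hε : 0 < ε) (hεδ : 8 * ε ≤ δ) (hε26 : 8 * ε ≤ 0.026)
    (hΘ : Real.sqrt (∫ x, (g.gradSq χ₁ x + g.gradSq χ₂ x) ^ 2
      ∂(riemannianMeasure (g.toContMDiffRiemannianMetric hg))) ≤ Θ)
    (hcost : 4 / Y * max (3 * (4 + 2 * Real.log (4 * Real.pi) - 2 * Real.log Y) + 6 * Real.log 6 - 6) 0 * Θ ≤ ε)
    (hKS : 2 * S ^ 3 / ε ≤ K) (hKT : 16 * T * Λ ≤ ε ^ 2 * K ^ 2) :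
    ∀ τ : ℝ, 0 < τ → τ ≤ T → ∀ w : M → ℝ, ContMDiff (𝓡 4) 𝓘(ℝ, ℝ) ∞ w →
      ∫ x, (4 * Real.pi * τ) ^ (-(4 : ℝ) / 2) * (w x) ^ 2 * (ψ x) ^ 4
          ∂(riemannianMeasure (g.toContMDiffRiemannianMetric hg)) = 1 →
        Real.log 2 + Real.log Real.pi / 2 - 3 / 2 + ε ≤
          ∫ x, (τ * ((ψ x ^ 3)⁻¹ * (g.scalarCurvature x * ψ x - 6 * g.dalembertian ψ x) * (w x) ^ 2
                + 4 * ((ψ x)⁻¹ ^ 2 * g.gradSq w x))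
            - (w x) ^ 2 * Real.log ((w x) ^ 2) - 4 * (w x) ^ 2)
            * ((4 * Real.pi * τ) ^ (-(4 : ℝ) / 2) * (ψ x) ^ 4)
          ∂(riemannianMeasure (g.toContMDiffRiemannianMetric hg)) := by
  intro τ hτ hτT w hw hnorm
  have hS0 : 0 < S := zero_lt_one.trans hS
  have hS3 : 0 < S ^ 3 := by positivity
  have hε4 : 0 < ε / 4 := by positivity
  have hε41 : ε / 4 < 1 := by linarith
  have hGc : ContinuousOn G {p}ᶜ := hGs.continuousOn
  -- the core clause on `U₁ = {x ≠ p, G < S³}`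
  have hcore := gluingCoreClause M g hg p G hGs hGpos (Real.log 2 + Real.log Real.pi / 2 - 3 / 2 + δ) hBlow
    K hK ψ hψ hψpos hψG hLψ (S ^ 3) Λ hS3 hΛ0 hΛ τ (ε / 4) hτ hε4 hε41
  -- supports
  have hU₁ : tsupport χ₁ ⊆ {x | x ≠ p ∧ G x < S ^ 3} :=
    GluingSmallScales.tsupport_inner_subset hGc hGlim hS hzero hχ₁p
  have hU₂ : tsupport χ₂ ⊆ U :=
    GluingSmallScales.tsupport_outer_subset hGc h1 hone hpU hcapt
  -- (a) `2 log(1 − ε/4) ≥ −ε`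
  have ha : -ε ≤ 2 * Real.log (1 - ε / 4) := by
    have h := GluingConstants.neg_two_mul_le_log_one_sub (x := ε / 4) hε4.le (by linarith)
    linarith
  -- (b) `8 log(1 + S³/4K) ≤ 2S³/K ≤ ε`
  have hx0 : 0 ≤ S ^ 3 / (4 * K) := by positivity
  have hKS' : 2 * S ^ 3 ≤ ε * K := by
    have := (div_le_iff₀ hε).1 hKS
    linarith
  have hb : 8 * Real.log (1 + S ^ 3 / (4 * K)) ≤ ε := by
    have h := GluingConstants.log_one_add_le hx0
    have h2 : 8 * (S ^ 3 / (4 * K)) ≤ ε := by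
      rw [show 8 * (S ^ 3 / (4 * K)) = 2 * S ^ 3 / K by field_simp; ring, div_le_iff₀ hK]
      linarith
    linarith
  -- (c) the `τ`-term is `≤ ε`
  have hc : 16 * τ * Real.exp (2 * Real.log (1 + S ^ 3 / (4 * K))) * (Real.sqrt Λ / (4 * K)) ^ 2 / (ε / 4) ≤ ε := by
    have hy : 0 < 1 + S ^ 3 / (4 * K) := by positivity
    have hexp : Real.exp (2 * Real.log (1 + S ^ 3 / (4 * K))) = (1 + S ^ 3 / (4 * K)) ^ 2 := by
      rw [two_mul, Real.exp_add, Real.exp_log hy, sq]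
    have hxle : S ^ 3 / (4 * K) ≤ 1 := by
      rw [div_le_iff₀ (by positivity)]
      nlinarith
    have hE : (1 + S ^ 3 / (4 * K)) ^ 2 ≤ 4 := by nlinarith
    have hL : (Real.sqrt Λ / (4 * K)) ^ 2 = Λ / (16 * K ^ 2) := by
      rw [div_pow, Real.sq_sqrt hΛ0]; ring
    rw [hexp, hL]
    have hK2 : 0 < K ^ 2 * ε := by positivity
    have hτT' : 16 * τ * Λ ≤ 16 * T * Λ := by nlinarith
    calc 16 * τ * (1 + S ^ 3 / (4 * K)) ^ 2 * (Λ / (16 * K ^ 2)) / (ε / 4)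
        ≤ 16 * τ * 4 * (Λ / (16 * K ^ 2)) / (ε / 4) := by
          gcongr
      _ = 16 * τ * Λ / (K ^ 2 * ε) := by field_simp; ring
      _ ≤ 16 * T * Λ / (K ^ 2 * ε) := div_le_div_of_nonneg_right hτT' hK2.le
      _ ≤ ε := by
          rw [div_le_iff₀ hK2]
          nlinarith
  have hLneg : Real.log 2 + Real.log Real.pi / 2 - 3 / 2 + ε < 0 :=
    GluingConstants.nuCyl_add_lt_zero (by linarith)
  have hm := Summit.SmoothPoincare4.Cruxes.SubcylindricalExistence.Negative.margin_gt
  have hL₁' : Real.log 2 + Real.log Real.pi / 2 - 3 / 2 + ε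
      + 4 / Y * max (3 * (4 + 2 * Real.log (4 * Real.pi) - 2 * Real.log Y) + 6 * Real.log 6 - 6) 0 * Θ ≤
      Real.log 2 + Real.log Real.pi / 2 - 3 / 2 + δ + 2 * Real.log (1 - ε / 4) - 8 * Real.log (1 + S ^ 3 / (4 * K))
        - 16 * τ * Real.exp (2 * Real.log (1 + S ^ 3 / (4 * K))) * (Real.sqrt Λ / (4 * K)) ^ 2 / (ε / 4)
        - τ * 0 := by
    linarith
  have hL₂' : Real.log 2 + Real.log Real.pi / 2 - 3 / 2 + ε
      + 4 / Y * max (3 * (4 + 2 * Real.log (4 * Real.pi) - 2 * Real.log Y) + 6 * Real.log 6 - 6) 0 * Θ ≤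
      Real.log 6 - 2 - 4 * ε := by
    linarith
  exact gluingLocalisedClause M g hg τ Y Θ (Real.log 2 + Real.log Real.pi / 2 - 3 / 2 + ε) _ (Real.log 6 - 2 - 4 * ε)
    hτ hY ψ χ₁ χ₂ hψ hψpos hLψ hχ₁ hχ₂ h1 {x | x ≠ p ∧ G x < S ^ 3} U hU₁ hU₂ hcore (hcap τ hτ) hYS hΘ hLneg
    hL₁' hL₂' w hw hnorm

end GluingSmallScalesSchwarzschild

/-- **The small-scale clause of the conformally-round-capped blow-up** (Schwarzschild gauge; registered
sub-goal `gluingSmallScalesSchwarzschild` of Stub D' of line `green-blowup-conformal-entropy`; ∀-form of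
`GluingSmallScalesSchwarzschild.smallScales_clause`). [cite: Perelman2002Entropy, §3.1] -/
theorem gluingSmallScalesSchwarzschild :
    ∀ (M : Type) [TopologicalSpace M] [T2Space M] [SecondCountableTopology M]
      [ChartedSpace (EuclideanSpace ℝ (Fin 4)) M] [IsManifold (𝓡 4) ∞ M] [CompactSpace M]
      [T3Space M] [MeasurableSpace M] [BorelSpace M]
      (g : PseudoRiemannianMetric (𝓡 4) ∞ (EuclideanSpace ℝ (Fin 4)) (TangentSpace (𝓡 4) : M → Type _))
      [g.HasLeviCivita] (hg : g.IsRiemannian) (p : M) (G : M → ℝ),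
      ContMDiffOn (𝓡 4) 𝓘(ℝ, ℝ) ∞ G {p}ᶜ → (∀ x, x ≠ p → 0 < G x) → Tendsto G (𝓝[≠] p) atTop →
      ∀ (δ : ℝ),
      (∀ τ : ℝ, 0 < τ → ∀ w : M → ℝ, ContMDiff (𝓡 4) 𝓘(ℝ, ℝ) ∞ w → w =ᶠ[𝓝 p] 0 →
        ∫ x, (4 * Real.pi * τ) ^ (-(4 : ℝ) / 2) * (w x) ^ 2 * (G x) ^ 4
            ∂(riemannianMeasure (g.toContMDiffRiemannianMetric hg)) = 1 →
          Real.log 2 + Real.log Real.pi / 2 - 3 / 2 + δ ≤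
            ∫ x, (4 * τ * ((G x)⁻¹ ^ 2 * g.gradSq w x) - (w x) ^ 2 * Real.log ((w x) ^ 2)
              - 4 * (w x) ^ 2) * ((4 * Real.pi * τ) ^ (-(4 : ℝ) / 2) * (G x) ^ 4)
            ∂(riemannianMeasure (g.toContMDiffRiemannianMetric hg))) →
      ∀ (K : ℝ), 0 < K → ∀ (ψ : M → ℝ), ContMDiff (𝓡 4) 𝓘(ℝ, ℝ) ∞ ψ → (∀ x, 0 < ψ x) →
      (∀ x, x ≠ p → ψ x = 4 * K * G x / (4 * K + G x)) →
      (∀ x, 0 < g.scalarCurvature x * ψ x - 6 * g.dalembertian ψ x) →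
      ∀ (Y : ℝ), 0 < Y →
      (∀ u : M → ℝ, ContMDiff (𝓡 4) 𝓘(ℝ, ℝ) ∞ u →
        Y * Real.sqrt (∫ x, u x ^ 4 * ψ x ^ 4 ∂(riemannianMeasure (g.toContMDiffRiemannianMetric hg))) ≤
          ∫ x, (6 * (ψ x ^ 2 * g.gradSq u x)
              + ψ x * (g.scalarCurvature x * ψ x - 6 * g.dalembertian ψ x) * u x ^ 2)
            ∂(riemannianMeasure (g.toContMDiffRiemannianMetric hg))) →
      ∀ (U : Set M), p ∈ U → ∀ (ε : ℝ),
      (∀ τ : ℝ, 0 < τ → ∀ v : M → ℝ, ContMDiff (𝓡 4) 𝓘(ℝ, ℝ) ∞ v → tsupport v ⊆ U →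
        ∫ x, (4 * Real.pi * τ) ^ (-(4 : ℝ) / 2) * (v x) ^ 2 * (ψ x) ^ 4
            ∂(riemannianMeasure (g.toContMDiffRiemannianMetric hg)) = 1 →
          Real.log 6 - 2 - 4 * ε ≤
            ∫ x, (τ * ((ψ x ^ 3)⁻¹ * (g.scalarCurvature x * ψ x - 6 * g.dalembertian ψ x) * (v x) ^ 2
                  + 4 * ((ψ x)⁻¹ ^ 2 * g.gradSq v x))
              - (v x) ^ 2 * Real.log ((v x) ^ 2) - 4 * (v x) ^ 2)
              * ((4 * Real.pi * τ) ^ (-(4 : ℝ) / 2) * (ψ x) ^ 4)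
            ∂(riemannianMeasure (g.toContMDiffRiemannianMetric hg))) →
      ∀ (S : ℝ), 1 < S → ∀ (Λ : ℝ), 0 ≤ Λ →
      (∀ x, x ≠ p → G x < S ^ 3 → (G x)⁻¹ ^ 2 * g.gradSq G x ≤ Λ) →
      ∀ (χ₁ χ₂ : M → ℝ), ContMDiff (𝓡 4) 𝓘(ℝ, ℝ) ∞ χ₁ → ContMDiff (𝓡 4) 𝓘(ℝ, ℝ) ∞ χ₂ →
      (∀ y, χ₁ y ^ 2 + χ₂ y ^ 2 = 1) → (∀ x, x ≠ p → G x ≤ S → χ₁ x = 1) →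
      (∀ x, x ≠ p → S ^ 2 ≤ G x → χ₁ x = 0) → χ₁ p = 0 → (∀ x, x ≠ p → S ≤ G x → x ∈ U) →
      ∀ (Θ T : ℝ), 0 < ε → 8 * ε ≤ δ → 8 * ε ≤ 0.026 →
      Real.sqrt (∫ x, (g.gradSq χ₁ x + g.gradSq χ₂ x) ^ 2
        ∂(riemannianMeasure (g.toContMDiffRiemannianMetric hg))) ≤ Θ →
      4 / Y * max (3 * (4 + 2 * Real.log (4 * Real.pi) - 2 * Real.log Y) + 6 * Real.log 6 - 6) 0 * Θ ≤ ε →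
      2 * S ^ 3 / ε ≤ K → 16 * T * Λ ≤ ε ^ 2 * K ^ 2 →
      ∀ τ : ℝ, 0 < τ → τ ≤ T → ∀ w : M → ℝ, ContMDiff (𝓡 4) 𝓘(ℝ, ℝ) ∞ w →
        ∫ x, (4 * Real.pi * τ) ^ (-(4 : ℝ) / 2) * (w x) ^ 2 * (ψ x) ^ 4
            ∂(riemannianMeasure (g.toContMDiffRiemannianMetric hg)) = 1 →
          Real.log 2 + Real.log Real.pi / 2 - 3 / 2 + ε ≤
            ∫ x, (τ * ((ψ x ^ 3)⁻¹ * (g.scalarCurvature x * ψ x - 6 * g.dalembertian ψ x) * (w x) ^ 2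
                  + 4 * ((ψ x)⁻¹ ^ 2 * g.gradSq w x))
              - (w x) ^ 2 * Real.log ((w x) ^ 2) - 4 * (w x) ^ 2)
              * ((4 * Real.pi * τ) ^ (-(4 : ℝ) / 2) * (ψ x) ^ 4)
            ∂(riemannianMeasure (g.toContMDiffRiemannianMetric hg)) := by
  intro M _ _ _ _ _ _ _ _ _ g _ hg p G hGs hGpos hGlim δ hBlow K hK ψ hψ hψpos hψG hLψ Y hY hYS U hpU ε hcap S hS Λ hΛ0
    hΛ χ₁ χ₂ hχ₁ hχ₂ h1 hone hzero hχ₁p hcapt Θ T hε hεδ hε26 hΘ hcost hKS hKT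
  exact GluingSmallScalesSchwarzschild.smallScales_clause g hg hGs hGpos hGlim hBlow hK hψ hψpos hψG hLψ hY hYS hpU hcap
    hS hΛ0 hΛ hχ₁ hχ₂ h1 hone hzero hχ₁p hcapt hε hεδ hε26 hΘ hcost hKS hKT

end Summit.SmoothPoincare4.SmoothPoincare4.Theorems

end
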